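import Mathlib.Analysis.Calculus.ContDiff.RCLike
import Mathlib.Analysis.Calculus.InverseFunctionTheorem.Deriv
import Summits.FinalStateConjecture.FinalStateConjecture.Theorems.SoloBlindLocality

/-!
# Solo (blind) — curves: immersion at `0` forces injectivity near `0`; the negation normal form without the injectivity clause

Sequel to `SoloBlindLocality.lean` (tame codimension is a germ condition;
`soloBlind_hasTameCodimAtLeastIn_iff_local`, `soloBlind_not_statement_iff`). For the summit's case
`m = 1` the injectivity clause of Christodoulou genericity is AUTOMATIC at the germ level:

* `soloBlind_contDiff_components` — the scalar components `c ↦ h_c(x)(u,w)`, `c ↦ k_c(x)(u,w)` of a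
  jointly smooth family (`InitialDataSet.IsSmoothDataFamily`) are smooth in the parameter
  (Mathlib's `ContMDiff.clm_bundle_apply₂` applied to constant sections over the constant base map);
* `soloBlind_injOn_of_fderiv_ne_zero` — a `C¹` function `ℝ¹ → ℝ` with non-zero differential at
  `0` is injective on a ball around `0` (inverse function theorem on the line);
* `soloBlind_injOn_of_isImmersedAtZero_one` — hence a jointly smooth curve of data immersed at `0`
  (`InitialDataSet.IsImmersedAtZero 1`) is injective on some parameter ball.

Consequently the negation normal form of the summit sheds its injectivity hypothesis
(`soloBlind_not_isTameChristodoulouGeneric_one_iff`, `soloBlind_not_statement_iff_curves`): the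
final state conjecture FAILS iff some admissible `Σ` carries an admissible non-settling datum `d`
such that EVERY admissible curve germ through `d`, tame on an end and immersed at `0`, contains
non-settling data at parameters `c ≠ 0` arbitrarily close to `0`. This is the exact burden of a
refutation: a family-robust exceptional phenomenon (e.g. an open set of admissible data around `d`
in any topology finer than all tame immersed curves), never a single exceptional datum.

References: D. Christodoulou, CQG 16 (1999) A23–A35, p. A24; Ann. Math. 149 (1999) 183–217,
p. 187.
-/

noncomputable section

set_option linter.dupNamespace false

open Literature.Geometry.Lorentzian Set Metric Filter Bundle
open scoped Manifold ContDiff Topology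

namespace Summit.FinalStateConjecture.FinalStateConjecture.Theorems

/-! ### Curves (`m = 1`): immersion at `0` forces injectivity near `0` -/

section Curves

variable {E : Type*} [NormedAddCommGroup E] [NormedSpace ℝ E] {H : Type*} [TopologicalSpace H]
  {I : ModelWithCorners ℝ E H} {X : Type*} [TopologicalSpace X] [ChartedSpace H X]
  [IsManifold I ∞ X]

/-- The scalar components `c ↦ h_c(x)(u, w)` and `c ↦ k_c(x)(u, w)` of a jointly smooth family are
smooth functions of the parameter (apply the smooth bilinear-form-valued map to the constant
sections `u`, `w` over the constant base map `c ↦ x`; `ContMDiff.clm_bundle_apply₂`). [folklore] -/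
theorem soloBlind_contDiff_components {m : ℕ}
    {F : EuclideanSpace ℝ (Fin m) → InitialDataSet I X} (hF : InitialDataSet.IsSmoothDataFamily m F)
    (x : X) (u w : TangentSpace I x) :
    ContDiff ℝ ∞ (fun c ↦ (F c).h.inner x u w) ∧ ContDiff ℝ ∞ (fun c ↦ (F c).k x u w) := by
  have hι : ContMDiff 𝓘(ℝ, EuclideanSpace ℝ (Fin m)) ((𝓘(ℝ, EuclideanSpace ℝ (Fin m))).prod I) ∞
      (fun c : EuclideanSpace ℝ (Fin m) ↦ (c, x)) := contMDiff_id.prodMk contMDiff_const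
  have hu : ContMDiff 𝓘(ℝ, EuclideanSpace ℝ (Fin m)) (I.prod 𝓘(ℝ, E)) ∞
      (fun _ : EuclideanSpace ℝ (Fin m) ↦ (TotalSpace.mk' E x u : TangentBundle I X)) :=
    contMDiff_const
  have hw : ContMDiff 𝓘(ℝ, EuclideanSpace ℝ (Fin m)) (I.prod 𝓘(ℝ, E)) ∞
      (fun _ : EuclideanSpace ℝ (Fin m) ↦ (TotalSpace.mk' E x w : TangentBundle I X)) :=
    contMDiff_const
  constructor
  · have h2 : ContMDiff 𝓘(ℝ, EuclideanSpace ℝ (Fin m)) (I.prod 𝓘(ℝ, ℝ)) ∞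
        (fun c ↦ TotalSpace.mk' ℝ (E := Bundle.Trivial X ℝ) x ((F c).h.inner x u w)) :=
      ContMDiff.clm_bundle_apply₂ (F₁ := E) (F₂ := E) (hF.1.comp hι) hu hw
    exact contMDiff_iff_contDiff.1 fun c ↦ (contMDiffAt_totalSpace.1 (h2 c)).2
  · have h2 : ContMDiff 𝓘(ℝ, EuclideanSpace ℝ (Fin m)) (I.prod 𝓘(ℝ, ℝ)) ∞
        (fun c ↦ TotalSpace.mk' ℝ (E := Bundle.Trivial X ℝ) x ((F c).k x u w)) :=
      ContMDiff.clm_bundle_apply₂ (F₁ := E) (F₂ := E) (hF.2.comp hι) hu hw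
    exact contMDiff_iff_contDiff.1 fun c ↦ (contMDiffAt_totalSpace.1 (h2 c)).2

/-- One-variable calculus: a `C¹` function `s : ℝ¹ → ℝ` with non-zero differential at `0` is
injective on a ball around `0` (inverse function theorem on the line, after the identification
`ℝ¹ ≃L[ℝ] ℝ`). [folklore] -/
theorem soloBlind_injOn_of_fderiv_ne_zero {s : EuclideanSpace ℝ (Fin 1) → ℝ} (hs : ContDiff ℝ 1 s)
    {v : EuclideanSpace ℝ (Fin 1)} (hv : fderiv ℝ s 0 v ≠ 0) :
    ∃ δ > 0, InjOn s (ball (0 : EuclideanSpace ℝ (Fin 1)) δ) := by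
  let Φ : EuclideanSpace ℝ (Fin 1) ≃L[ℝ] ℝ :=
    (EuclideanSpace.equiv (Fin 1) ℝ).trans (ContinuousLinearEquiv.funUnique (Fin 1) ℝ ℝ)
  set g : ℝ → ℝ := s ∘ Φ.symm with hg_def
  have hg : ContDiff ℝ 1 g := hs.comp Φ.symm.contDiff
  have hg0 : deriv g 0 ≠ 0 := by
    intro h0
    have h1 : fderiv ℝ s 0 (Φ.symm 1) = 0 := by
      have := Φ.symm.comp_right_fderiv (f := s) (x := 0)
      rw [← fderiv_apply_one_eq_deriv, hg_def, this, ContinuousLinearMap.comp_apply, map_zero] at h0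
      exact h0
    apply hv
    have hv' : v = Φ v • Φ.symm 1 := by
      rw [← map_smul, smul_eq_mul, mul_one, ContinuousLinearEquiv.symm_apply_apply]
    rw [hv', map_smul, h1, smul_zero]
  have hstrict : HasStrictDerivAt g (deriv g 0) 0 := hg.contDiffAt.hasStrictDerivAt one_ne_zero
  obtain ⟨U, hU, hU0, hinjg⟩ : ∃ U : Set ℝ, IsOpen U ∧ (0 : ℝ) ∈ U ∧ InjOn g U :=
    ⟨_, ((hstrict.hasStrictFDerivAt_equiv hg0).toOpenPartialHomeomorph g).open_source,
      (hstrict.hasStrictFDerivAt_equiv hg0).mem_toOpenPartialHomeomorph_source,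
      by simpa using ((hstrict.hasStrictFDerivAt_equiv hg0).toOpenPartialHomeomorph g).injOn⟩
  have hV : IsOpen (Φ ⁻¹' U) := hU.preimage Φ.continuous
  have hV0 : (0 : EuclideanSpace ℝ (Fin 1)) ∈ Φ ⁻¹' U := by simpa using hU0
  obtain ⟨δ, hδ, hball⟩ := Metric.isOpen_iff.1 hV 0 hV0
  refine ⟨δ, hδ, fun a ha b hb hab ↦ ?_⟩
  have hga : g (Φ a) = s a := by simp [hg_def]
  have hgb : g (Φ b) = s b := by simp [hg_def]
  exact Φ.injective (hinjg (hball ha) (hball hb) (by rw [hga, hgb, hab]))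

/-- **For curves, immersion at `0` gives injectivity near `0`.** A jointly smooth `1`-parameter
family immersed at `0` is injective on some parameter ball around `0`: one scalar component has
non-zero derivative at `0`, hence is injective near `0`. So for `m = 1` the injectivity clause of
Christodoulou genericity is automatic at the germ level. [folklore] -/
theorem soloBlind_injOn_of_isImmersedAtZero_one {F : EuclideanSpace ℝ (Fin 1) → InitialDataSet I X}
    (hF : InitialDataSet.IsSmoothDataFamily 1 F) (hI : InitialDataSet.IsImmersedAtZero 1 F) :
    ∃ δ > 0, InjOn F (ball (0 : EuclideanSpace ℝ (Fin 1)) δ) := by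
  obtain ⟨x, u, w, h⟩ := hI (EuclideanSpace.single 0 1) (by simp)
  obtain ⟨hs, hs'⟩ := soloBlind_contDiff_components hF x u w
  rcases h with h | h
  · obtain ⟨δ, hδ, hinj⟩ :=
      soloBlind_injOn_of_fderiv_ne_zero (hs.of_le (by exact_mod_cast le_top)) h
    exact ⟨δ, hδ, fun a ha b hb hab ↦ hinj ha hb (by simp only [hab])⟩
  · obtain ⟨δ, hδ, hinj⟩ :=
      soloBlind_injOn_of_fderiv_ne_zero (hs'.of_le (by exact_mod_cast le_top)) h
    exact ⟨δ, hδ, fun a ha b hb hab ↦ hinj ha hb (by simp only [hab])⟩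

end Curves

/-! ### Negation normal forms without the injectivity clause -/

section NormalForms

variable {X : Type*} [TopologicalSpace X] [ChartedSpace E3 X] [IsManifold (𝓡 3) ∞ X]

/-- **Negation normal form for curves (`m = 1`), injectivity clause removed.** Since a tame
immersed curve is automatically injective near `0` (`soloBlind_injOn_of_isImmersedAtZero_one`),
`P` fails to be tame-generic with codimension `1` inside `𝓓` iff some admissible exceptional datum
`d` is such that EVERY admissible curve germ through `d`, tame on an end and immersed at `0`, has
exceptional members at parameters `≠ 0` in every ball. [folklore] -/
theorem soloBlind_not_isTameChristodoulouGeneric_one_iff {𝓓 : Set (InitialDataSet (𝓡 3) X)}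
    {P : InitialDataSet (𝓡 3) X → Prop} :
    ¬ InitialDataSet.IsTameChristodoulouGeneric 𝓓 P 1 ↔
      ∃ d ∈ 𝓓, ¬ P d ∧
        ∀ (e : AFEnd X) (F : EuclideanSpace ℝ (Fin 1) → InitialDataSet (𝓡 3) X),
          InitialDataSet.IsTameDataFamily e 1 F → InitialDataSet.IsImmersedAtZero 1 F → F 0 = d →
            ∀ δ > 0, (∀ c ∈ ball (0 : EuclideanSpace ℝ (Fin 1)) δ, F c ∈ 𝓓) →
              ∃ c ∈ ball (0 : EuclideanSpace ℝ (Fin 1)) δ, c ≠ 0 ∧ ¬ P (F c) := by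
  rw [soloBlind_not_isTameChristodoulouGeneric_iff]
  refine exists_congr fun d ↦ and_congr_right fun _ ↦ and_congr_right fun _ ↦
    forall_congr' fun e ↦ forall_congr' fun F ↦ ⟨fun h hF hI h0 δ hδ hD ↦ ?_,
      fun h hF hI h0 δ hδ _ hD ↦ h hF hI h0 δ hδ hD⟩
  obtain ⟨δ₁, hδ₁, hinj⟩ := soloBlind_injOn_of_isImmersedAtZero_one hF.1 hI
  obtain ⟨c, hc, hc0, hcP⟩ := h hF hI h0 (min δ δ₁) (lt_min hδ hδ₁)
    (hinj.mono (ball_subset_ball (min_le_right _ _)))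
    (fun c hc ↦ hD c (ball_subset_ball (min_le_left _ _) hc))
  exact ⟨c, ball_subset_ball (min_le_left _ _) hc, hc0, hcP⟩

end NormalForms

/-- **What a refutation of the final state conjecture must exhibit.** The summit fails iff some
admissible `Σ` carries an admissible vacuum datum `d` which does not settle and such that EVERY
admissible `1`-parameter germ through `d` — tame on an asymptotically flat end and immersed at
`0` (injectivity near `0` is then automatic) — contains non-settling data at parameters `c ≠ 0`
arbitrarily close to `0`: a family-robust exceptional phenomenon, not merely an exceptional datum.
[folklore] -/
theorem soloBlind_not_statement_iff_curves :
    ¬ FinalStateConjecture ↔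
      ∃ (X : Type) (_ : TopologicalSpace X) (_ : ChartedSpace E3 X) (_ : IsManifold (𝓡 3) ∞ X)
        (_ : T2Space X) (_ : SecondCountableTopology X) (_ : ConnectedSpace X),
        ∃ d ∈ admissibleVacuumData X, ¬ SoloBlindSettles X d ∧
          ∀ (e : AFEnd X) (F : EuclideanSpace ℝ (Fin 1) → InitialDataSet (𝓡 3) X),
            InitialDataSet.IsTameDataFamily e 1 F → InitialDataSet.IsImmersedAtZero 1 F → F 0 = d →
              ∀ δ > 0, (∀ c ∈ ball (0 : EuclideanSpace ℝ (Fin 1)) δ, F c ∈ admissibleVacuumData X) →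
                ∃ c ∈ ball (0 : EuclideanSpace ℝ (Fin 1)) δ, c ≠ 0 ∧ ¬ SoloBlindSettles X (F c) := by
  rw [soloBlind_statement_iff]
  push Not
  simp only [soloBlind_not_isTameChristodoulouGeneric_one_iff]

end Summit.FinalStateConjecture.FinalStateConjecture.Theorems

end
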